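import Summits.ValiantsHypothesis.ValiantsHypothesis.Theorems.FifoMatchingArcCover
import Summits.ValiantsHypothesis.ValiantsHypothesis.Theorems.FifoMatchingTimeCutMatching
import Summits.ValiantsHypothesis.ValiantsHypothesis.Theses.FifoMatching
import HarnessLib

/-!
# `FifoMatching.TimeCutFoolingSet` — an explicit fooling set across the time cut `t = n`

Closes route item `stmt-ValiantsHypothesis-11621` (`Theses.FifoMatching.TimeCutFoolingSet`).

With `j := ⌈n/3⌉ = (n+2)/3` and `k := n - 2j` (so `n = 2j + k`, `k ≤ j`, and `n ≤ 4k` once `n ≥ 16`)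
we take `m := 2^k` and, for a bit vector `b : Fin k → Fin 2` (`r ↦ b` through
`finFunctionFinEquiv`), the nest-free perfect matching `M_b` of `[0, 2n)` of
`FifoMatchingTimeCutMatching` (`TimeCut.pm`): short pairs on `[0, 2j)`, crossing arcs
`2j + i ↔ n + 2i + b_i`, second-half arcs `n + 2i + (1 - b_i) ↔ n + 2k + i` (`i < k`), tail short
pairs on `[n + 3k, 2n)`. `A_b` (resp. `B_b`) is the set of arcs of `M_b` opened before (resp. at or
after) time `n`, so `A_b ∪ B_b = arcs M_b` and the diagonal coefficient is `1`
(`coeff_indicator_nnSum`, an involution is determined by its arcs); for `b ≠ b'`, differing at bit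
`i`, the position `x := n + 2i + b_i` closes the crossing arc `(2j + i, x) ∈ A_b` and opens the
second-half arc `(x, n + 2k + i) ∈ B_{b'}`, so `A_b ∪ B_{b'}` has two distinct arcs sharing an endpoint
and is the arc set of no involution (`no_involution_of_shared_endpoint`): the coefficient is `0`.
Finally `2^{n/4} ≤ 2^k = m` for `n ≥ 16` (`c := 1/4`, `n₀ := 16`). [folklore; Nisan 1991-style
fooling set / partial-derivative matrix of full rank `2^{Ω(n)}` across the cut]

Honest framing: an elementary explicit construction on a dormant route; nothing here bears on
`VP ≠ VNP` itself.
-/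

noncomputable section

-- layout Summits/ValiantsHypothesis/ValiantsHypothesis forces the duplicated namespace component
set_option linter.dupNamespace false

namespace Summit.ValiantsHypothesis.ValiantsHypothesis.Theorems.FifoMatching

namespace TimeCut

variable {j k n : ℕ}

/-- A bit vector `b : Fin k → Fin 2` read as a function `ℕ → ℕ` (extended by `0`). [folklore] -/
def bbOf (k : ℕ) (b : Fin k → Fin 2) (i : ℕ) : ℕ :=
  if h : i < k then (b ⟨i, h⟩ : ℕ) else 0

/-- The extended bit vector takes values `≤ 1`. [folklore] -/
theorem bbOf_le (b : Fin k → Fin 2) (i : ℕ) : bbOf k b i ≤ 1 := by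
  unfold bbOf
  split_ifs with h
  · have := (b ⟨i, h⟩).isLt
    omega
  · omega

/-- The extended bit vector agrees with `b` below `k`. [folklore] -/
theorem bbOf_coe (b : Fin k → Fin 2) (i : Fin k) : bbOf k b i = (b i : ℕ) := by
  unfold bbOf
  rw [dif_pos i.isLt]

/-- The matching `M_b` as a self-map of `Fin (2n)`. [folklore] -/
def mfin (j k n : ℕ) (h1 : n = 2 * j + k) (h2 : k ≤ j) (b : Fin k → Fin 2) :
    Fin (2 * n) → Fin (2 * n) :=
  fun p => ⟨pm j k n (bbOf k b) p, pm_lt h1 h2 (bbOf_le b) p.isLt⟩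

/-- `M_b` is a nest-free fixed-point-free involution (the route's matching predicate). [folklore] -/
theorem mfin_valid (h1 : n = 2 * j + k) (h2 : k ≤ j) (b : Fin k → Fin 2) :
    (∀ p, mfin j k n h1 h2 b (mfin j k n h1 h2 b p) = p) ∧ (∀ p, mfin j k n h1 h2 b p ≠ p) ∧
      ∀ p q : Fin (2 * n), p < q → q < mfin j k n h1 h2 b q →
        mfin j k n h1 h2 b q < mfin j k n h1 h2 b p → False := by
  refine ⟨fun p => Fin.ext (pm_pm h1 (bbOf_le b) p.isLt), fun p h => ?_, fun p q hpq hqo hcl => ?_⟩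
  · exact pm_ne h1 (congrArg Fin.val h)
  · exact pm_nonnest h1 (bbOf_le b) p.isLt q.isLt hpq hqo hcl

/-- `A_b`: the arcs of `M_b` opened before time `n`. [folklore] -/
def setA (j k n : ℕ) (h1 : n = 2 * j + k) (h2 : k ≤ j) (b : Fin k → Fin 2) :
    Finset (Fin (2 * n) × Fin (2 * n)) :=
  (arcs (mfin j k n h1 h2 b)).filter fun e => (e.1 : ℕ) < n

/-- `B_b`: the arcs of `M_b` opened at or after time `n`. [folklore] -/
def setB (j k n : ℕ) (h1 : n = 2 * j + k) (h2 : k ≤ j) (b : Fin k → Fin 2) :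
    Finset (Fin (2 * n) × Fin (2 * n)) :=
  (arcs (mfin j k n h1 h2 b)).filter fun e => ¬ (e.1 : ℕ) < n

/-- Arcs of `A_b` open before the cut. [folklore] -/
theorem fst_lt_of_mem_setA {h1 : n = 2 * j + k} {h2 : k ≤ j} {b : Fin k → Fin 2}
    {e : Fin (2 * n) × Fin (2 * n)} (he : e ∈ setA j k n h1 h2 b) : (e.1 : ℕ) < n :=
  (Finset.mem_filter.mp he).2

/-- Arcs of `B_b` open at or after the cut. [folklore] -/
theorem le_fst_of_mem_setB {h1 : n = 2 * j + k} {h2 : k ≤ j} {b : Fin k → Fin 2}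
    {e : Fin (2 * n) × Fin (2 * n)} (he : e ∈ setB j k n h1 h2 b) : n ≤ (e.1 : ℕ) :=
  Nat.le_of_not_lt (Finset.mem_filter.mp he).2

/-- `A_b ∪ B_b` is the arc set of `M_b`. [folklore] -/
theorem setA_union_setB (h1 : n = 2 * j + k) (h2 : k ≤ j) (b : Fin k → Fin 2) :
    setA j k n h1 h2 b ∪ setB j k n h1 h2 b = arcs (mfin j k n h1 h2 b) :=
  Finset.filter_union_filter_not_eq _ _

/-- The crossing arc `(2j + i, n + 2i + b_i)` lies in `A_b`. [folklore] -/
theorem mem_setA_of (h1 : n = 2 * j + k) (h2 : k ≤ j) (b : Fin k → Fin 2) {i : ℕ} (hi : i < k)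
    {o c : Fin (2 * n)} (ho : (o : ℕ) = 2 * j + i) (hc : (c : ℕ) = n + 2 * i + bbOf k b i) :
    (o, c) ∈ setA j k n h1 h2 b := by
  unfold setA
  rw [Finset.mem_filter, mem_arcs]
  refine ⟨⟨?_, ?_⟩, ?_⟩
  · show (o : ℕ) < pm j k n (bbOf k b) o
    rw [ho, pm_C h1 hi]
    omega
  · apply Fin.ext
    show (c : ℕ) = pm j k n (bbOf k b) o
    rw [ho, hc, pm_C h1 hi]
  · show (o : ℕ) < n
    omega

/-- The second-half arc `(n + 2i + (1 - b_i), n + 2k + i)` lies in `B_b`. [folklore] -/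
theorem mem_setB_of (h1 : n = 2 * j + k) (h2 : k ≤ j) (b : Fin k → Fin 2) {i : ℕ} (hi : i < k)
    {o c : Fin (2 * n)} (ho : (o : ℕ) = n + 2 * i + (1 - bbOf k b i))
    (hc : (c : ℕ) = n + 2 * k + i) : (o, c) ∈ setB j k n h1 h2 b := by
  unfold setB
  rw [Finset.mem_filter, mem_arcs]
  refine ⟨⟨?_, ?_⟩, ?_⟩
  · show (o : ℕ) < pm j k n (bbOf k b) o
    rw [ho, pm_Rop h1 (bbOf_le b) hi]
    omega
  · apply Fin.ext
    show (c : ℕ) = pm j k n (bbOf k b) o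
    rw [ho, hc, pm_Rop h1 (bbOf_le b) hi]
  · show ¬ (o : ℕ) < n
    omega

/-- **Diagonal entries:** `A_b ∪ B_b` is the arc set of a nest-free matching. [folklore] -/
theorem diag (h1 : n = 2 * j + k) (h2 : k ≤ j) (b : Fin k → Fin 2) :
    ∃ M : Fin (2 * n) → Fin (2 * n),
      ((∀ i, M (M i) = i) ∧ (∀ i, M i ≠ i) ∧ ∀ i j, i < j → j < M j → M j < M i → False) ∧
        arcs M = setA j k n h1 h2 b ∪ setB j k n h1 h2 b :=
  ⟨mfin j k n h1 h2 b, mfin_valid h1 h2 b, (setA_union_setB h1 h2 b).symm⟩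

/-- **Off-diagonal entries:** for `b ≠ b'`, `A_b ∪ B_{b'}` is the arc set of no involution — at a
bit `i` where they differ, the position `n + 2i + b_i` closes an arc of `A_b` and opens an arc of
`B_{b'}`. [folklore] -/
theorem offdiag (h1 : n = 2 * j + k) (h2 : k ≤ j) {b b' : Fin k → Fin 2} (hbb : b ≠ b') :
    ¬ ∃ M : Fin (2 * n) → Fin (2 * n),
      ((∀ i, M (M i) = i) ∧ (∀ i, M i ≠ i) ∧ ∀ i j, i < j → j < M j → M j < M i → False) ∧
        arcs M = setA j k n h1 h2 b ∪ setB j k n h1 h2 b' := by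
  rintro ⟨M, hM, hF⟩
  obtain ⟨i, hi⟩ := Function.ne_iff.mp hbb
  have hik : (i : ℕ) < k := i.isLt
  have hbi := bbOf_le b i
  have h3 : bbOf k b' i = 1 - bbOf k b i := by
    have hv : (b i : ℕ) ≠ (b' i : ℕ) := fun h => hi (Fin.ext h)
    have := (b i).isLt
    have := (b' i).isLt
    rw [bbOf_coe, bbOf_coe]
    omega
  obtain ⟨o, ho⟩ : ∃ o : Fin (2 * n), (o : ℕ) = 2 * j + i := ⟨⟨_, by omega⟩, rfl⟩
  obtain ⟨x, hx⟩ : ∃ x : Fin (2 * n), (x : ℕ) = n + 2 * i + bbOf k b i := ⟨⟨_, by omega⟩, rfl⟩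
  obtain ⟨c, hc⟩ : ∃ c : Fin (2 * n), (c : ℕ) = n + 2 * k + i := ⟨⟨_, by omega⟩, rfl⟩
  have he : (o, x) ∈ setA j k n h1 h2 b ∪ setB j k n h1 h2 b' :=
    Finset.mem_union_left _ (mem_setA_of h1 h2 b hik ho hx)
  have he' : (x, c) ∈ setA j k n h1 h2 b ∪ setB j k n h1 h2 b' :=
    Finset.mem_union_right _ (mem_setB_of h1 h2 b' hik (by omega) hc)
  have hne : (o, x) ≠ (x, c) := by
    intro h
    have := congrArg (fun e : Fin (2 * n) × Fin (2 * n) => (e.1 : ℕ)) h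
    dsimp only at this
    omega
  exact no_involution_of_shared_endpoint he he' hne (Or.inr rfl) (Or.inl rfl) hM.1 hF

end TimeCut

open TimeCut in
/-- **Route item `TimeCutFoolingSet`** (stmt-ValiantsHypothesis-11621): with `c = 1/4` and
`n₀ = 16`, for every `n ≥ n₀` the `2^k ≥ 2^{n/4}` pairs `(A_b, B_b)` of arc sets — `A_b` opened
before time `n`, `B_b` at or after — satisfy `coeff_{A_b ∪ B_{b'}}(NN_n) = [b = b']`, an identity
submatrix of the opener-time flattening of the nest-free matching polynomial `NN_n`. [folklore;
Nisan 1991-style fooling set] -/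
theorem timeCutFoolingSet_proof :
    Summit.ValiantsHypothesis.ValiantsHypothesis.Theses.FifoMatching.TimeCutFoolingSet := by
  unfold Summit.ValiantsHypothesis.ValiantsHypothesis.Theses.FifoMatching.TimeCutFoolingSet
  refine ⟨1 / 4, by norm_num, 16, fun n hn => ?_⟩
  obtain ⟨j, k, h1, h2, h4⟩ : ∃ j k : ℕ, n = 2 * j + k ∧ k ≤ j ∧ n ≤ 4 * k :=
    ⟨(n + 2) / 3, n - 2 * ((n + 2) / 3), by omega, by omega, by omega⟩
  refine ⟨2 ^ k, fun r => setA j k n h1 h2 (finFunctionFinEquiv.symm r),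
    fun r => setB j k n h1 h2 (finFunctionFinEquiv.symm r), ?_, ?_, ?_, ?_⟩
  · -- growth: `2^{n/4} ≤ 2^k`
    have hk : (1 / 4 : ℝ) * n ≤ (k : ℝ) := by
      have : (n : ℝ) ≤ 4 * (k : ℝ) := by exact_mod_cast h4
      linarith
    calc (2 : ℝ) ^ ((1 / 4 : ℝ) * n) ≤ (2 : ℝ) ^ (k : ℝ) :=
          Real.rpow_le_rpow_of_exponent_le (by norm_num) hk
      _ = ((2 ^ k : ℕ) : ℝ) := by rw [Real.rpow_natCast]; norm_cast
  · intro r e he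
    exact fst_lt_of_mem_setA he
  · intro r e he
    exact le_fst_of_mem_setB he
  · intro r s
    rw [coeff_indicator_nnSum n]
    by_cases hrs : r = s
    · subst hrs
      rw [if_pos rfl, if_pos (diag h1 h2 _)]
    · have hbb : finFunctionFinEquiv.symm r ≠ finFunctionFinEquiv.symm s :=
        fun h => hrs (finFunctionFinEquiv.symm.injective h)
      rw [if_neg hrs, if_neg (offdiag h1 h2 hbb)]

end Summit.ValiantsHypothesis.ValiantsHypothesis.Theorems.FifoMatching

end
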